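import Mathlib

/-!
# `Φ₀` for two petals: the (Ȳ, g)-block of the charging inequality is nonnegative

In the normalised two-petal setting of `…SunflowerPhiZeroPair` (`a_j = ε_Y(x_j − 1)` the Ȳ-excess, `ζ_j = z_j − 1` the
`g`-excess of petal `j`), the part of `pay − cross` that involves only Ȳ- and `g`-excesses is the bilinear form
`F = (1/ε_Y − 1)a₁a₂ − ε_g(a₁ζ₂ + a₂ζ₁) + ε_g(1−ε_g)ζ₁ζ₂`.
The identity `ε_Y(1−ε_Y)·F = d₁d₂ + ε_gε_Y(1 − ε_Y − ε_g)ζ₁ζ₂` with `d_j = (1−ε_Y)a_j − ε_gε_Yζ_j` gives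
`F ≥ 0` as soon as `d_j ≥ 0` (`charging_Yg_block_nonneg`); `d_j ≥ 0` is the model tying
`ε_gε_Y ≤ ε_k(1−ε_Y)` (⟸ the leaf-leaf constant: `(1−τ)(1−σ)b_Ȳ ≤ c₀ + q b_H`, `model_tying_Yg`) combined with the link
`a_j ≥ ε_k(k̂_j − 1) ≥ ε_kζ_j`.  Numerically (pair_split.py, 300k model pairs) `F ≥ 0` always, while the remaining `h`-block
needs `F`'s surplus jointly with the leverage pot (prove-1 g54 memo §7(g)(ix)).  [this work]
-/

namespace Summit.CriticalPhenomena.PercolationContinuityZ3.Theorems.SunflowerPartition.SafeCalc.LinkedCurrency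

/-- **The (Ȳ,g)-block is nonnegative.**  For `0 < ε_Y`, `0 ≤ ε_g`, `ε_Y + ε_g ≤ 1`, `ζ_j ≥ 0` and petals whose Ȳ-excess
covers their `g`-excess in the sense `ε_gε_Yζ_j ≤ (1−ε_Y)a_j`:
`ε_g(a₁ζ₂ + a₂ζ₁) ≤ (1/ε_Y − 1)a₁a₂ + ε_g(1−ε_g)ζ₁ζ₂` — the Ȳ×g cross terms of two petals are paid by the Ȳ×Ȳ surplus and
the g×g diagonal (hub × dwarf and dwarf × dwarf, memo §1/§7). [this work] -/
theorem charging_Yg_block_nonneg {εY εg a₁ a₂ ζ₁ ζ₂ : ℝ} (hY0 : 0 < εY) (hY1 : εY < 1) (hg0 : 0 ≤ εg)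
    (hYg : εY + εg ≤ 1)
    (hζ1 : 0 ≤ ζ₁) (hζ2 : 0 ≤ ζ₂) (hd1 : εg * εY * ζ₁ ≤ (1 - εY) * a₁) (hd2 : εg * εY * ζ₂ ≤ (1 - εY) * a₂) :
    εg * (a₁ * ζ₂ + a₂ * ζ₁) ≤ (1 / εY - 1) * (a₁ * a₂) + εg * (1 - εg) * (ζ₁ * ζ₂) := by
  have hY1' : 0 < 1 - εY := by linarith
  have hdd : 0 ≤ ((1 - εY) * a₁ - εg * εY * ζ₁) * ((1 - εY) * a₂ - εg * εY * ζ₂) :=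
    mul_nonneg (by linarith) (by linarith)
  have hzz : 0 ≤ εg * εY * (1 - εY - εg) * (ζ₁ * ζ₂) :=
    mul_nonneg (mul_nonneg (mul_nonneg hg0 hY0.le) (by linarith)) (mul_nonneg hζ1 hζ2)
  -- ε_Y(1−ε_Y)·(pay-block − cross-block) = hdd + hzz ≥ 0
  have key : εY * (1 - εY) * ((1 / εY - 1) * (a₁ * a₂) + εg * (1 - εg) * (ζ₁ * ζ₂) - εg * (a₁ * ζ₂ + a₂ * ζ₁)) =
      ((1 - εY) * a₁ - εg * εY * ζ₁) * ((1 - εY) * a₂ - εg * εY * ζ₂) +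
        εg * εY * (1 - εY - εg) * (ζ₁ * ζ₂) := by
    field_simp
    ring
  have hpos : 0 < εY * (1 - εY) := mul_pos hY0 hY1'
  have hD : 0 ≤ (1 / εY - 1) * (a₁ * a₂) + εg * (1 - εg) * (ζ₁ * ζ₂) - εg * (a₁ * ζ₂ + a₂ * ζ₁) := by
    rw [← mul_nonneg_iff_of_pos_left hpos, key]
    exact add_nonneg hdd hzz
  linarith

/-- **Model tying for the (Ȳ,g)-block** (`ε_gε_Y ≤ ε_k(1−ε_Y)` in the model): with `p = τ(1−σ)`, `q = s(1−τ)`,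
`b_Ȳ = (1−s)α₀₀ + sα₀₁`, `b_H = (1−σ)α₀₁ + σα₁₁`: if `(1−τ)(1−s)(1−σ)α₀₀ ≤ c₀` (true for the
leaf-leaf constants `c₀ ≥ τσ + (1−s)(1−τ)(1−σ)α₀₀`) then `q(1−σ)·b_Ȳ ≤ s·(c₀ + q·b_H)`, which is
`ε_gε_Y ≤ ε_k(1−ε_Y)` after multiplying by `p α₀₁/g²`. [this work] -/
theorem model_tying_Yg {τ σ s α00 α01 α11 c0 : ℝ} (hτ1 : τ ≤ 1) (hσ0 : 0 ≤ σ) (hσ1 : σ ≤ 1) (hs0 : 0 ≤ s)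
    (hα01 : 0 ≤ α01) (h11 : α01 ≤ α11)
    (hc0 : (1 - τ) * (1 - s) * (1 - σ) * α00 ≤ c0) :
    s * (1 - τ) * (1 - σ) * ((1 - s) * α00 + s * α01) ≤
      s * (c0 + s * (1 - τ) * ((1 - σ) * α01 + σ * α11)) := by
  have h1 : 0 ≤ s * (1 - τ) := mul_nonneg hs0 (sub_nonneg.2 hτ1)
  have h2 : 0 ≤ s * (s * (1 - τ)) * σ * ((1 - σ) * α01) :=
    mul_nonneg (mul_nonneg (mul_nonneg hs0 h1) hσ0) (mul_nonneg (sub_nonneg.2 hσ1) hα01)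
  have h3 : 0 ≤ s * (s * (1 - τ)) * σ * α11 :=
    mul_nonneg (mul_nonneg (mul_nonneg hs0 h1) hσ0) (hα01.trans h11)
  have h4 := mul_le_mul_of_nonneg_left hc0 hs0
  nlinarith [mul_nonneg h1 (sub_nonneg.2 hσ1)]

end Summit.CriticalPhenomena.PercolationContinuityZ3.Theorems.SunflowerPartition.SafeCalc.LinkedCurrency
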